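import Summits.QuantumAdvantage.AdviceFreeQNC0.R1DisjointReads39
import Summits.QuantumAdvantage.AdviceFreeQNC0.R1PairMass39
import HarnessLib

/-!
# Cell qa-qnc0, `p = 3` — the STRUCTURED BRANCH (graded seeds ⊕ scattered juntas) UNCONDITIONALLY, for pairwise-disjoint and for
# bounded-multiplicity outside reads (prover qn-prover-3 g25; sequel of `R1DisjointReads39` / `R1PairMass39`)

`GradedSeeds38.gradedJuntaReductionS : 0 ≤ ρ → 3ρ^α < 1 → TwistedJuntaBoundX3S ρ → SeedJuntaHardXS α` (prover g22, planner p2 g36's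
P2-36a(iii)) consumes (R1) only at the SAME tolerance set `W` and the SAME reading sets `T` as the strategy it bounds.  Hence any
restriction of (R1) to a class of pairs `(W, T)` yields the structured branch for the same class — `seedJuntaHard_of_restrictedR1`, the
proof of `gradedJuntaReductionS` verbatim with an admissibility predicate `Q N W T` threaded through.  With the restricted (R1) theorems
of the fibre method (`twistedJuntaBoundX3S_of_disjointReads`, `twistedJuntaBoundX3S_of_readMultiplicity`):

* **`GradedSeeds38.seedJuntaHardXS_of_disjointReads`** — graded-spread seeds (schedule `(log₂N)^C·(50(j+1) + D·log₂N)` outside `W`,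
  `3·#W ≤ N`) ⊕ juntas `H k (seed residues) x` reading `T k` with `#(T k ∖ W) ≤ (log₂N)^C` and the `T k ∖ W` PAIRWISE DISJOINT win the
  ring game on `≤ θ·2^{N−1}` odd inputs, ONE `θ < 1`, every `C`, every number of seeds — UNCONDITIONAL;
* **`GradedSeeds38.seedJuntaHardXS_of_readMultiplicity`** — the same for outside reads of multiplicity `≤ m` (schedule `50m(j+1) + …`),
  every `m ≥ 1` — UNCONDITIONAL.

(`3·(39/40)^50 < 1`; for multiplicity `m`, `ρ_m^{50m} = (39/40)^50`.)  The general structured branch `SeedJuntaHardXS` (arbitrary overlaps of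
the outside reads) still waits for (R1) in the dense-overlap regime (`R1PairMass39` docstring).

WHAT THIS IS NOT: nothing on overlapping outside reads of unbounded multiplicity; crux `stmt-QuantumAdvantage-22907` untouched.
-/

noncomputable section

namespace Summit.QuantumAdvantage.AdviceFreeQNC0

open Finset Literature.Computability.QuantumComplexity Literature.Computability.MetaComplexity

namespace GradedSeeds38

open TwistedJunta36

section Restricted

open scoped Classical in
/-- **The structured-branch reduction for a RESTRICTED (R1).**  If (R1) holds for all pairs `(W, T)` satisfying an admissibility
predicate `Q N W T`, then every seed ⊕ junta strategy whose `(W, T)` satisfies `Q` wins on `≤ θ·2^{N−1}` odd inputs (inflated schedule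
`(log₂N)^C·(α(j+1) + D·log₂N)`).  Proof = `gradedJuntaReductionS` verbatim (`coverPolylogHard` main term, graded expansion
`sum_le_max_add_graded`, geometric error), with `Q` passed to the twisted bound. -/
theorem seedJuntaHard_of_restrictedR1 (Q : (N : ℕ) → Finset (Fin N) → (Fin N → Finset (Fin N)) → Prop)
    {ρ : ℝ} {α : ℕ} (hρ : 0 ≤ ρ) (hq : 3 * ρ ^ α < 1)
    (hTJ : ∀ C : ℕ, ∃ A n₀ : ℕ, ∀ N ≥ n₀,
      ∀ (W : Finset (Fin N)) (T : Fin N → Finset (Fin N)) (g : Fin N → (Fin N → Bool) → Bool),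
        3 * W.card ≤ N → (∀ k, (T k \ W).card ≤ (Nat.log 2 N) ^ C) → Q N W T →
        (∀ k (x x' : Fin N → Bool), (∀ i ∈ T k, x i = x' i) → g k x = g k x') →
          ∀ β : Fin N → ZMod 3,
            ‖∑ x : Fin N → Bool, (ZMod.stdAddChar (∑ i : Fin N, if x i then β i else 0) : ℂ) *
                (if (OddZeros x ∧ RingHLF.Rel x (fun k => g k x)) then (1 : ℂ) else 0)‖
              ≤ (N : ℝ) ^ A * ρ ^ ((univ.filter fun i : Fin N => i ∉ W ∧ β i ≠ 0).card / (Nat.log 2 N) ^ C) * (2 : ℝ) ^ N) :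
    ∃ θ : ℝ, θ < 1 ∧ ∀ C : ℕ, ∃ D n₀ : ℕ, ∀ N ≥ n₀,
      ∀ (W : Finset (Fin N)) (R : ℕ) (c : Fin R → Fin N → ZMod 3) (T : Fin N → Finset (Fin N))
        (H : Fin N → (Fin R → ZMod 3) → (Fin N → Bool) → Bool),
        3 * W.card ≤ N → GradedSpreadOff W c (fun j => (Nat.log 2 N) ^ C * (α * (j.val + 1) + D * Nat.log 2 N)) →
        (∀ k, (T k \ W).card ≤ (Nat.log 2 N) ^ C) → Q N W T →
        (∀ k v (x x' : Fin N → Bool), (∀ i ∈ T k, x i = x' i) → H k v x = H k v x') →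
          ((univ.filter fun x : Fin N → Bool =>
              OddZeros x ∧ RingHLF.Rel x (fun k => H k (LinForms.resVec c x) x)).card : ℝ)
            ≤ θ * (2 : ℝ) ^ (N - 1) := by
  classical
  obtain ⟨θ, hθ, hcover⟩ := AffBells34.coverPolylogHard
  refine ⟨(1 + θ) / 2, by linarith, fun C => ?_⟩
  obtain ⟨n₁, hn₁⟩ := hcover C
  obtain ⟨A, n₂, hn₂⟩ := hTJ C
  -- the ratio `q = 3ρ^α ∈ [0,1)` and `ρ^α ≤ 1/2`, `ρ ≤ 1`
  have hρα0 : 0 ≤ ρ ^ α := pow_nonneg hρ α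
  have hq0 : 0 ≤ 3 * ρ ^ α := by positivity
  have hρα : ρ ^ α ≤ 1 / 2 := by linarith
  have hρ1 : ρ ≤ 1 := by
    by_contra h
    have h1 : 1 ≤ ρ ^ α := one_le_pow₀ (le_of_lt (not_le.1 h))
    linarith
  have h1θ : 0 < (1 - θ) / 2 := by linarith
  -- the error constant
  obtain ⟨n₃, hn₃⟩ : ∃ n₃ : ℕ, (2 : ℝ) ^ (A + 2) * (3 * ρ ^ α / (1 - 3 * ρ ^ α)) / ((1 - θ) / 2) ≤ n₃ :=
    ⟨_, Nat.le_ceil _⟩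
  refine ⟨α * (A + 1), max (max n₁ n₂) (max n₃ 2), fun N hN W R c T H hW hspread hT hQ hH => ?_⟩
  have hN1 : n₁ ≤ N := le_trans (le_trans (le_max_left _ _) (le_max_left _ _)) hN
  have hN2 : n₂ ≤ N := le_trans (le_trans (le_max_right _ _) (le_max_left _ _)) hN
  have hN3 : n₃ ≤ N := le_trans (le_trans (le_max_left _ _) (le_max_right _ _)) hN
  have hNtwo : 2 ≤ N := le_trans (le_trans (le_max_right _ _) (le_max_right _ _)) hN
  have hNone : 1 ≤ N := by omega
  have hNpos : (0 : ℝ) < N := by exact_mod_cast hNone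
  set L : ℕ := Nat.log 2 N with hL
  set P : (Fin R → ZMod 3) → (Fin N → Bool) → Prop := fun v x =>
    OddZeros x ∧ RingHLF.Rel x (fun k => H k v x) with hP
  set Bj : Fin R → ℝ := fun j => (N : ℝ) ^ A * ρ ^ (α * (j.val + 1) + α * (A + 1) * L) * (2 : ℝ) ^ N with hBj
  have hBj0 : ∀ j, 0 ≤ Bj j := fun j => by positivity
  -- (a) main term: frozen seed residues give a `W`-tolerant polylog-junta strategy (`coverPolylogHard`)
  have ha : ∀ v : Fin R → ZMod 3,
      ∑ x : Fin N → Bool, (if P v x then (1 : ℝ) else 0) ≤ θ * (2 : ℝ) ^ (N - 1) := by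
    intro v
    have h := hn₁ N hN1 W T (fun k x => H k v x) hW hT (fun k => fun x x' hxx' => hH k v x x' hxx')
    rw [sum_boole]
    simpa [AffBells22.winCount, hP] using h
  -- (b) graded twisted sums: the RESTRICTED twisted junta bound (exponent `#(supp β ∖ W) / (log₂N)^C`)
  have hb : ∀ (v γ : Fin R → ZMod 3) (j : Fin R), IsTop γ j →
      ‖∑ x : Fin N → Bool, (ZMod.stdAddChar (∑ i, γ i * LinForms.resVec c x i) : ℂ) *
          ((if P v x then (1 : ℝ) else 0 : ℝ) : ℂ)‖ ≤ Bj j := by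
    intro v γ j hj
    set β : Fin N → ZMod 3 := fun m => ∑ i, γ i * c i m with hβ
    have hres : ∀ x : Fin N → Bool, ∑ i, γ i * LinForms.resVec c x i = ∑ m, if x m then β m else 0 := by
      intro x
      simp only [LinForms.resVec, hβ, mul_sum]
      rw [sum_comm]
      refine sum_congr rfl fun m _ => ?_
      split_ifs <;> simp
    have h := hn₂ N hN2 W T (fun k x => H k v x) hW hT hQ (fun k x x' hxx' => hH k v x x' hxx') β
    have hcast : ∀ x : Fin N → Bool, (((if P v x then (1 : ℝ) else 0 : ℝ)) : ℂ) = (if P v x then (1 : ℂ) else 0) := by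
      intro x; split_ifs <;> simp
    simp_rw [hres, hcast]
    refine le_trans (by simpa [hP] using h) ?_
    have hLC : 0 < L ^ C := by
      have hL1 : 1 ≤ L := by rw [hL]; exact Nat.le_log_of_pow_le (by norm_num) (by simpa using hNtwo)
      exact pow_pos (by omega) C
    have hw0 : L ^ C * (α * (j.val + 1) + α * (A + 1) * L) ≤ (univ.filter fun i : Fin N => i ∉ W ∧ β i ≠ 0).card :=
      hspread γ j hj
    have hw : α * (j.val + 1) + α * (A + 1) * L ≤ (univ.filter fun i : Fin N => i ∉ W ∧ β i ≠ 0).card / L ^ C := by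
      rw [Nat.le_div_iff_mul_le hLC, mul_comm]; exact hw0
    calc (N : ℝ) ^ A * ρ ^ ((univ.filter fun i : Fin N => i ∉ W ∧ β i ≠ 0).card / L ^ C) * (2 : ℝ) ^ N
        ≤ (N : ℝ) ^ A * ρ ^ (α * (j.val + 1) + α * (A + 1) * L) * (2 : ℝ) ^ N := by
          gcongr _ * ?_ * _
          exact pow_le_pow_of_le_one hρ hρ1 hw
      _ = Bj j := rfl
  -- the graded expansion
  have hmain := sum_le_max_add_graded (p := 3) (fun x : Fin N → Bool => LinForms.resVec c x)
    (fun v x => if P v x then (1 : ℝ) else 0) (θ * (2 : ℝ) ^ (N - 1)) Bj hBj0 ha hb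
  have hset : ((univ.filter fun x : Fin N → Bool =>
      OddZeros x ∧ RingHLF.Rel x (fun k => H k (LinForms.resVec c x) x)).card : ℝ)
      = ∑ x : Fin N → Bool, (if P (LinForms.resVec c x) x then (1 : ℝ) else 0) := by
    rw [sum_boole]
  rw [hset]
  refine hmain.trans ?_
  -- (c) the error term `Σ_j 3^{j+1} Bj j ≤ ((1-θ)/2)·2^{N-1}`
  have herr : ∑ j : Fin R, ((3 : ℕ) : ℝ) ^ (j.val + 1) * Bj j ≤ ((1 - θ) / 2) * (2 : ℝ) ^ (N - 1) := by
    have hterm : ∀ j : Fin R, ((3 : ℕ) : ℝ) ^ (j.val + 1) * Bj j =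
        (3 * ρ ^ α) ^ (j.val + 1) * ((N : ℝ) ^ A * (ρ ^ α) ^ ((A + 1) * L) * (2 : ℝ) ^ N) := by
      intro j
      have e1 : ρ ^ (α * (j.val + 1) + α * (A + 1) * L) = (ρ ^ α) ^ (j.val + 1) * (ρ ^ α) ^ ((A + 1) * L) := by
        rw [pow_add, pow_mul, mul_assoc, pow_mul]
      have eB : Bj j = (N : ℝ) ^ A * ρ ^ (α * (j.val + 1) + α * (A + 1) * L) * (2 : ℝ) ^ N := rfl
      rw [eB, e1, mul_pow]; push_cast; ring
    rw [sum_congr rfl fun j _ => hterm j, ← sum_mul]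
    have hN2 : (2 : ℝ) ^ N = 2 * (2 : ℝ) ^ (N - 1) := by
      rw [← pow_succ']; congr 1; omega
    have hgeo := sum_pow_succ_le_div (3 * ρ ^ α) hq0 hq R
    have hdec := pow_mul_decay_le N A hNone (ρ ^ α) hρα0 hρα
    have hq1 : 0 < 1 - 3 * ρ ^ α := by linarith
    have hK0 : 0 ≤ 3 * ρ ^ α / (1 - 3 * ρ ^ α) := div_nonneg hq0 hq1.le
    have hp : (0 : ℝ) ≤ (2 : ℝ) ^ (N - 1) := by positivity
    -- `N ≥ n₃` gives `2^{A+2} · (q/(1-q)) / N ≤ (1-θ)/2`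
    have hN3' : (2 : ℝ) ^ (A + 2) * (3 * ρ ^ α / (1 - 3 * ρ ^ α)) / ((1 - θ) / 2) ≤ N :=
      hn₃.trans (by exact_mod_cast hN3)
    have hkey : (2 : ℝ) ^ (A + 2) * (3 * ρ ^ α / (1 - 3 * ρ ^ α)) / N ≤ (1 - θ) / 2 := by
      rw [div_le_iff₀ hNpos]
      rw [div_le_iff₀ h1θ] at hN3'
      linarith
    calc (∑ j : Fin R, (3 * ρ ^ α) ^ (j.val + 1)) * ((N : ℝ) ^ A * (ρ ^ α) ^ ((A + 1) * L) * (2 : ℝ) ^ N)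
        ≤ (3 * ρ ^ α / (1 - 3 * ρ ^ α)) * ((2 : ℝ) ^ (A + 1) / N * (2 : ℝ) ^ N) := by
          refine mul_le_mul hgeo ?_ (by positivity) hK0
          exact mul_le_mul_of_nonneg_right hdec (by positivity)
      _ = ((2 : ℝ) ^ (A + 2) * (3 * ρ ^ α / (1 - 3 * ρ ^ α)) / N) * (2 : ℝ) ^ (N - 1) := by
          rw [hN2]; ring
      _ ≤ ((1 - θ) / 2) * (2 : ℝ) ^ (N - 1) := mul_le_mul_of_nonneg_right hkey hp
  have h3 : ∑ j : Fin R, ((3 : ℕ) : ℝ) ^ (j.val + 1) * Bj j = ∑ j : Fin R, (3 : ℝ) ^ (j.val + 1) * Bj j := by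
    push_cast; rfl
  linarith [herr]

end Restricted

/-- `3 · (39/40)^50 < 1`. -/
theorem three_mul_rho_pow_fifty_lt_one : 3 * (39 / 40 : ℝ) ^ 50 < 1 := by norm_num

open scoped Classical in
/-- **THE STRUCTURED BRANCH FOR PAIRWISE-DISJOINT SCATTERED JUNTAS — UNCONDITIONAL.**  Graded-spread seeds (schedule
`(log₂N)^C·(50(j+1) + D·log₂N)` outside `W`, `3·#W ≤ N`) ⊕ juntas reading `T k` with `#(T k ∖ W) ≤ (log₂N)^C` and the outside reads
`T k ∖ W` pairwise disjoint: `≤ θ·2^{N−1}` winning odd inputs, one `θ < 1`, every `C`, every number `R` of seeds. -/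
theorem seedJuntaHardXS_of_disjointReads :
    ∃ θ : ℝ, θ < 1 ∧ ∀ C : ℕ, ∃ D n₀ : ℕ, ∀ N ≥ n₀,
      ∀ (W : Finset (Fin N)) (R : ℕ) (c : Fin R → Fin N → ZMod 3) (T : Fin N → Finset (Fin N))
        (H : Fin N → (Fin R → ZMod 3) → (Fin N → Bool) → Bool),
        3 * W.card ≤ N → GradedSpreadOff W c (fun j => (Nat.log 2 N) ^ C * (50 * (j.val + 1) + D * Nat.log 2 N)) →
        (∀ k, (T k \ W).card ≤ (Nat.log 2 N) ^ C) →
        (∀ k k', k ≠ k' → Disjoint (T k \ W) (T k' \ W)) →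
        (∀ k v (x x' : Fin N → Bool), (∀ i ∈ T k, x i = x' i) → H k v x = H k v x') →
          ((univ.filter fun x : Fin N → Bool =>
              OddZeros x ∧ RingHLF.Rel x (fun k => H k (LinForms.resVec c x) x)).card : ℝ)
            ≤ θ * (2 : ℝ) ^ (N - 1) :=
  seedJuntaHard_of_restrictedR1
    (fun N W T => ∀ k k' : Fin N, k ≠ k' → Disjoint (T k \ W) (T k' \ W))
    (ρ := 39 / 40) (α := 50) (by norm_num) three_mul_rho_pow_fifty_lt_one
    (fun C => twistedJuntaBoundX3S_of_disjointReads C)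

/-- `ρ_m^{50m} = (39/40)^50`. -/
theorem rho_pow_inv_pow (m : ℕ) (hm : 1 ≤ m) : ((39 / 40 : ℝ) ^ ((1 : ℝ) / m)) ^ (50 * m) = (39 / 40 : ℝ) ^ 50 := by
  have hρ : (0 : ℝ) ≤ 39 / 40 := by norm_num
  rw [← Real.rpow_natCast, ← Real.rpow_mul hρ]
  have hm' : (m : ℝ) ≠ 0 := by exact_mod_cast (show m ≠ 0 by omega)
  have : (1 : ℝ) / m * ((50 * m : ℕ) : ℝ) = ((50 : ℕ) : ℝ) := by push_cast; field_simp
  rw [this, Real.rpow_natCast]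

open scoped Classical in
/-- **THE STRUCTURED BRANCH FOR SCATTERED JUNTAS OF BOUNDED READ MULTIPLICITY — UNCONDITIONAL.**  As above with the outside reads of
multiplicity `≤ m` (every letter outside `W` lies in at most `m` of the sets `T k ∖ W`), schedule `(log₂N)^C·(50m(j+1) + D·log₂N)`,
every `m ≥ 1`. -/
theorem seedJuntaHardXS_of_readMultiplicity {m : ℕ} (hm : 1 ≤ m) :
    ∃ θ : ℝ, θ < 1 ∧ ∀ C : ℕ, ∃ D n₀ : ℕ, ∀ N ≥ n₀,
      ∀ (W : Finset (Fin N)) (R : ℕ) (c : Fin R → Fin N → ZMod 3) (T : Fin N → Finset (Fin N))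
        (H : Fin N → (Fin R → ZMod 3) → (Fin N → Bool) → Bool),
        3 * W.card ≤ N → GradedSpreadOff W c (fun j => (Nat.log 2 N) ^ C * (50 * m * (j.val + 1) + D * Nat.log 2 N)) →
        (∀ k, (T k \ W).card ≤ (Nat.log 2 N) ^ C) →
        (∀ j : Fin N, j ∉ W → (univ.filter fun k : Fin N => j ∈ T k \ W).card ≤ m) →
        (∀ k v (x x' : Fin N → Bool), (∀ i ∈ T k, x i = x' i) → H k v x = H k v x') →
          ((univ.filter fun x : Fin N → Bool =>
              OddZeros x ∧ RingHLF.Rel x (fun k => H k (LinForms.resVec c x) x)).card : ℝ)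
            ≤ θ * (2 : ℝ) ^ (N - 1) := by
  have hq : 3 * ((39 / 40 : ℝ) ^ ((1 : ℝ) / m)) ^ (50 * m) < 1 := by
    rw [rho_pow_inv_pow m hm]; exact three_mul_rho_pow_fifty_lt_one
  exact seedJuntaHard_of_restrictedR1
    (fun N W T => ∀ j : Fin N, j ∉ W → (univ.filter fun k : Fin N => j ∈ T k \ W).card ≤ m)
    (ρ := (39 / 40 : ℝ) ^ ((1 : ℝ) / m)) (α := 50 * m) (rho_pow_inv_nonneg m) hq
    (fun C => twistedJuntaBoundX3S_of_readMultiplicity hm C)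

end GradedSeeds38

end Summit.QuantumAdvantage.AdviceFreeQNC0

end
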